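import Summits.QuantumFields.BalabanUV.T4Continuum.Spine.NE9.DirectPairingMargin

/-!
# T⁴ programme, spine estimate NE9 — THE LINEAR CHANNEL OF THE OLD ACTION: (AN-OLD)+margin (census C37) from the printed STRUCTURE of
# Bałaban's step — old activities enter LINEARLY (potentials, [II] Lemma 1) into a functional HOLOMORPHIC on the convergence ball of the
# cluster expansion ([II] (2.14)) — and the margin IS the slack between the class radius and the convergence radius; coordinate read-outs;
# node U6 in King's currency from channel constants alone — census item C37b of cell `pub-balaban-gaps`, seat ne9 (gen 9)

Cell `pub-balaban-gaps` (YM blitz G2, seat ne9, unit `pub-balaban-gaps-ne9-g9`; record `run/shared/lean/pub/pub-balaban-gaps/ne/NE9.md` §5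
row C37b).  Summits-side bookkeeping; functional analysis on hypothesis SHAPES; NO definition; nothing of Bałaban's asserted.

CONTEXT.  `DirectPairingMargin` (C37) discharged King's run-uniform step clause [UC-OLD] on the non-compact class from (AN-OLD)+MARGIN: per
level one margin `ϱ` and one bound `M`, uniform over the runs, such that the step is holomorphic and bounded by `M` on the closed `ϱ`-balls
about the class.  Its docstring READ that clause off [Balaban1988RG2Cluster] as «the old action enters the fluctuation integral LINEARLY through
the potentials of Lemma 1 (1.33)–(1.36); the cluster expansion (2.14)–(2.20) is analytic in them and converges for κ sufficiently large; the
margin is the expansion's slack».  This file TYPES that reading as a structure theorem, so that the margin is no longer a hypothesis but a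
NUMBER made of printed-KIND constants.

THE MODEL (shapes).  Activities live in a complex Banach space `F` with the weighted sup norm of (1.18) (`‖E‖ = sup e^{κd(X)}|E(X, U)|`, so the
inductive class of level `j` is the closed ball `‖w‖ ≤ E₀ j`); potentials live in a complex normed space `P`.  ONE STEP at last coupling `c`
in run `s` is `w ↦ J s j c w + G s j c (T s j c w)`: `J` a continuous linear map (the old terms carried into the new action, re-expressed on the
new background — [Balaban1987RG1] (0.24)∕(2.13): the old `E^{(j)}` keep their form), `T` a continuous linear map activities → potentials
([II] Lemma 1: each old term contributes its own difference (1.33), bounded by (1.36) — operator norm `≤ C_T`), `G` the new term as a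
functional of the potentials, holomorphic on the ball `‖p‖ < R` where the expansion (2.14) converges and bounded by `M` there ((2.20), p. 21).

WHAT IS PROVED (0 sorry).
* §1 `oldMargin_of_linearChannel`: if the constants are uniform over runs and couplings per level and satisfy the SLACK inequality
  `C_T·(E₀ + ϱ) < R` for some `ϱ > 0`, then the step satisfies (AN-OLD)+margin — EXACTLY the `hO` binder of
  `DirectPairingMargin.uniformOld_of_margin` ∕ `king_U6_of_margin` — with margin `ϱ`, bound `C_J·(E₀ + ϱ) + M` and domain
  `{u : ‖T u‖ < R, ‖u‖ ≤ E₀ + ϱ}`; `uniformOld_of_linearChannel`: hence [UC-OLD] run-uniformly.  `slack_iff`: for `C_T > 0` a positive margin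
  with slack exists iff `C_T·E₀ < R` — the class of old activities must be mapped STRICTLY inside the convergence ball, and the gap is the margin
  (`ϱ < R∕C_T − E₀`).  This is the precise content of «κ sufficiently large» for THIS clause: (1.36)'s constant times the class radius below
  (2.14)'s radius, uniformly in the volume.
* §2 `readOut_uniform_of_coordinate` ∕ `bound_of_coordinate`: if the scale-`m` term at `(U, X)` is read from the state by
  `e^{−κd(X)}·Re ℓ(w)` with a coordinate functional `‖ℓ‖ ≤ 1` (evaluation at `(X, U)` in the weighted sup norm), then the read-out clause `hev` of
  the carriers theorems holds with `δ = ε`, and the (1.18)-type bound `hB` holds with `B = E₀` from class membership — two more binders of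
  `king_U6_of_margin` discharged by STRUCTURE.
* §3 `king_U6_of_linearChannel`: node U6 in King's currency on the tower of carriers (`DirectPairingMargin.king_U6_of_margin` BY NAME) from:
  tower-NE5 · the Markov recursion through the linear channel with a coupling-free start · class reproduction `‖V‖ ≤ E₀` · channel constants
  `(R, M, C_J, C_T)` per level, uniform in run and coupling, with slack · (AN-LAST)+margin · coordinate read-outs · node U2's summable profile.
  Every E-side binder is now a STRUCTURE (linear channel, coordinate read-out, Markov) or a CONSTANT of printed KIND; none is a modulus,
  none names an older coupling, none is a stabilisation.

HONEST FRAMING: bookkeeping for rung (B)+1 on ONE FIXED finite four-torus; analysis on hypothesis SHAPES.  That Bałaban's step HAS this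
linear-channel form with volume-uniform `(R, M, C_J, C_T, E₀)` and slack is an H∃ READING of [II] §§1–2 (locus W1, the one-step object,
instance 0∕1) — NOT PRINTED as a theorem, NOT PROVED here; tower-NE5 is the cell's estimate NE5 (NOT PRINTED, NOT PROVED); (AN-LAST)+margin
NOT PRINTED ∕ NOT PROVED; NE9 NOT PRINTED ∕ NOT PROVED; spine PROVED 0∕9 unchanged; NOT UV stability, NOT the continuum limit, NOT infinite
volume, NOT a mass gap, NOT Clay.  HONEST DEPENDENCY: continuum YM on T⁴ ⇐ BetaPertH ∧ nine spine estimates (0∕9 proved); BetaPertH ⇐ (D1) ∧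
(D4) ∧ CAP+tail.  CLASSIFICATION OF NE9 UNCHANGED: WORK-bound (W1).

References (TYPES only): [Balaban1987RG1] = T. Bałaban, Commun. Math. Phys. **109** (1987) 249–301, (0.24) p. 257, Thm 1 p. 259, (1.18)
p. 263, (2.13) p. 268; [Balaban1988RG2Cluster] = T. Bałaban, Commun. Math. Phys. **116** (1988) 1–22, Lemma 1 (1.33)–(1.36) p. 9, (2.14)–(2.20)
pp. 15–17, p. 21; [King1986] = C. King, Commun. Math. Phys. **102** (1986) 649–677, §3.2.
-/

namespace Summit.QuantumFields.BalabanUV.T4Continuum.NE9.DirectPairingMarginChannel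

open scoped BigOperators
open Filter Topology Metric Set
open Literature.MathematicalPhysics.QuantumFieldTheory.Balaban1983to89
open Literature.MathematicalPhysics.QuantumFieldTheory.Balaban1983to89.T4CouplingAnalyticity (BoxWindow)
open T4CauchySum (delta)
open Summit.QuantumFields.BalabanUV.T4Continuum.NE9.TowerCarriers
open Summit.QuantumFields.BalabanUV.T4Continuum.NE9.TowerCarriersBox (TowerNE5On)
open Summit.QuantumFields.BalabanUV.T4Continuum.NE9.DirectPairingMargin (uniformOld_of_margin king_U6_of_margin)

variable {F : Type*} [NormedAddCommGroup F] [NormedSpace ℂ F] [CompleteSpace F]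
variable {P : Type*} [NormedAddCommGroup P] [NormedSpace ℂ P]

/-! ## §1 The linear channel: (AN-OLD)+margin from slack -/

section Channel

variable {σ : Type*} {I : Set ℝ} {J : σ → ℕ → ℝ → (F →L[ℂ] F)} {T : σ → ℕ → ℝ → (F →L[ℂ] P)} {G : σ → ℕ → ℝ → P → F}
  {E₀ R M CJ CT ϱ : ℕ → ℝ}

omit [CompleteSpace F] in
/-- **THE LINEAR CHANNEL GIVES (AN-OLD)+MARGIN, AND THE MARGIN IS THE SLACK.**  Per level `j`: old terms carried by a continuous linear `J s j c`
(`‖J‖ ≤ C_J`), potentials formed by a continuous linear `T s j c` (`‖T‖ ≤ C_T`, [II] (1.36)), new term `G s j c` holomorphic on the potential ball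
`‖p‖ < R` with `‖G‖ ≤ M` there ([II] (2.14)–(2.20)), constants uniform over the member `s` and the last coupling `c ∈ I`, class = the closed
`E₀`-ball ((1.18)), and SLACK `C_T·(E₀ + ϱ) < R` with `ϱ > 0` ⇒ the step `w ↦ J w + G (T w)` is complex differentiable on
`D = {u : ‖T u‖ < R ∧ ‖u‖ ≤ E₀ + ϱ}`, bounded there by `C_J·(E₀ + ϱ) + M`, and `D` contains the closed `ϱ`-ball about every class element —
literally the `hO` binder of `DirectPairingMargin.uniformOld_of_margin`. [folklore] -/
theorem oldMargin_of_linearChannel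
    (hϱ : ∀ j, 0 < ϱ j)
    (hG : ∀ s j, ∀ c ∈ I, DifferentiableOn ℂ (G s j c) (ball 0 (R j)))
    (hM : ∀ s j, ∀ c ∈ I, ∀ p ∈ ball (0 : P) (R j), ‖G s j c p‖ ≤ M j)
    (hJ : ∀ s j, ∀ c ∈ I, ‖J s j c‖ ≤ CJ j) (hT : ∀ s j, ∀ c ∈ I, ‖T s j c‖ ≤ CT j)
    (hslack : ∀ j, CT j * (E₀ j + ϱ j) < R j) :
    ∀ j, ∃ ϱ' M' : ℝ, 0 < ϱ' ∧ ∀ s, ∀ c ∈ I, ∃ D : Set F,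
      DifferentiableOn ℂ (fun w => J s j c w + G s j c (T s j c w)) D ∧
        (∀ z ∈ D, ‖J s j c z + G s j c (T s j c z)‖ ≤ M') ∧ ∀ w ∈ closedBall (0 : F) (E₀ j), closedBall w ϱ' ⊆ D := by
  intro j
  refine ⟨ϱ j, CJ j * (E₀ j + ϱ j) + M j, hϱ j, fun s c hc => ?_⟩
  refine ⟨{u | ‖T s j c u‖ < R j ∧ ‖u‖ ≤ E₀ j + ϱ j}, ?_, ?_, ?_⟩
  · -- holomorphy: linear + holomorphic ∘ linear, on the preimage of the convergence ball
    have hmaps : MapsTo (fun u => T s j c u) {u : F | ‖T s j c u‖ < R j ∧ ‖u‖ ≤ E₀ j + ϱ j} (ball (0 : P) (R j)) := by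
      intro u hu
      rw [mem_ball, dist_zero_right]
      exact hu.1
    exact ((J s j c).differentiable.differentiableOn).add
      ((hG s j c hc).comp (T s j c).differentiable.differentiableOn hmaps)
  · intro z hz
    have h1 : ‖J s j c z‖ ≤ CJ j * (E₀ j + ϱ j) :=
      ((J s j c).le_of_opNorm_le (hJ s j c hc) z).trans
        (mul_le_mul_of_nonneg_left hz.2 ((norm_nonneg _).trans (hJ s j c hc)))
    have h2 : ‖G s j c (T s j c z)‖ ≤ M j := hM s j c hc _ (by rw [mem_ball, dist_zero_right]; exact hz.1)
    exact (norm_add_le _ _).trans (add_le_add h1 h2)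
  · intro w hw u hu
    rw [mem_closedBall, dist_zero_right] at hw
    rw [mem_closedBall, dist_eq_norm] at hu
    have hu' : ‖u‖ ≤ E₀ j + ϱ j := by
      calc ‖u‖ = ‖(u - w) + w‖ := by rw [sub_add_cancel]
        _ ≤ ‖u - w‖ + ‖w‖ := norm_add_le _ _
        _ ≤ ϱ j + E₀ j := add_le_add hu hw
        _ = E₀ j + ϱ j := add_comm _ _
    refine ⟨?_, hu'⟩
    calc ‖T s j c u‖ ≤ CT j * ‖u‖ := (T s j c).le_of_opNorm_le (hT s j c hc) u
      _ ≤ CT j * (E₀ j + ϱ j) := mul_le_mul_of_nonneg_left hu' ((norm_nonneg _).trans (hT s j c hc))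
      _ < R j := hslack j

/-- **[UC-OLD] RUN-UNIFORMLY FROM THE LINEAR CHANNEL** (`DirectPairingMargin.uniformOld_of_margin` BY NAME): for the step
`Φ s j c w = J s j c w + G s j c (T s j c w)` and the classes `A j = closedBall 0 (E₀ j)`, the `hold` binder of
`DirectPairingPropagation.propagate` holds with ONE `δ` per level for all runs and couplings. [folklore] -/
theorem uniformOld_of_linearChannel
    (hϱ : ∀ j, 0 < ϱ j)
    (hG : ∀ s j, ∀ c ∈ I, DifferentiableOn ℂ (G s j c) (ball 0 (R j)))
    (hM : ∀ s j, ∀ c ∈ I, ∀ p ∈ ball (0 : P) (R j), ‖G s j c p‖ ≤ M j)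
    (hJ : ∀ s j, ∀ c ∈ I, ‖J s j c‖ ≤ CJ j) (hT : ∀ s j, ∀ c ∈ I, ‖T s j c‖ ≤ CT j)
    (hslack : ∀ j, CT j * (E₀ j + ϱ j) < R j) :
    ∀ j, ∀ ε : ℝ, 0 < ε → ∃ δ : ℝ, 0 < δ ∧ ∀ s, ∀ c ∈ I, ∀ w ∈ closedBall (0 : F) (E₀ j), ∀ w' ∈ closedBall (0 : F) (E₀ j),
      dist w w' ≤ δ → dist (J s j c w + G s j c (T s j c w)) (J s j c w' + G s j c (T s j c w')) ≤ ε :=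
  uniformOld_of_margin (Φ := fun s j c w => J s j c w + G s j c (T s j c w)) (A := fun j => closedBall (0 : F) (E₀ j))
    (oldMargin_of_linearChannel hϱ hG hM hJ hT hslack)

end Channel

/-- **THE SLACK INEQUALITY**: for `C_T > 0`, a positive margin `ϱ` with `C_T·(E₀ + ϱ) < R` exists iff `C_T·E₀ < R` — the image of the class
must lie STRICTLY inside the convergence ball; every `ϱ < R∕C_T − E₀` serves.  (The content of «κ sufficiently large» for this clause.)
[folklore] -/
theorem slack_iff {CT E₀ R : ℝ} (hCT : 0 < CT) : (∃ ϱ : ℝ, 0 < ϱ ∧ CT * (E₀ + ϱ) < R) ↔ CT * E₀ < R := by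
  constructor
  · rintro ⟨ϱ, hϱ, h⟩
    have : CT * E₀ < CT * (E₀ + ϱ) := mul_lt_mul_of_pos_left (by linarith) hCT
    linarith
  · intro h
    refine ⟨(R / CT - E₀) / 2, ?_, ?_⟩
    · have : E₀ < R / CT := by rw [lt_div_iff₀ hCT]; linarith [mul_comm CT E₀]
      linarith
    · have hR : CT * (R / CT) = R := mul_div_cancel₀ R hCT.ne'
      nlinarith [hR]

/-! ## §2 Coordinate read-outs: the `hev` and `hB` binders from structure -/

section ReadOut

variable (T : TowerData) {κ : ℝ} {ℓ : ℕ → T.B → T.Dom → (F →L[ℂ] ℂ)}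

omit [CompleteSpace F] in
/-- **COORDINATE READ-OUTS ARE UNIFORMLY CONTINUOUS, RUN-UNIFORMLY** (the `hev` binder of the carriers theorems with `δ = ε`): if run `k`'s
scale-`m` term at `(U, X)` is read from the state `w` as `e^{−κd(X)}·Re (ℓ k U X w)` with a coordinate functional of norm `≤ 1` (evaluation at
`(X, U)` in the weighted sup norm of (1.18)), then `e^{κd(X)}·|ev w − ev w'| ≤ ‖w − w'‖`. [folklore] -/
theorem readOut_uniform_of_coordinate (hℓ : ∀ k U X, ‖ℓ k U X‖ ≤ 1) (A : ℕ → Set F) :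
    ∀ m, ∀ ε : ℝ, 0 < ε → ∃ δ : ℝ, 0 < δ ∧ ∀ (k : ℕ) (U : T.B) (X : T.Dom), T.r X + m = k →
      ∀ w ∈ A m, ∀ w' ∈ A m, dist w w' ≤ δ →
        Real.exp (κ * T.d X) * |(fun k U X w => Real.exp (-(κ * T.d X)) * (ℓ k U X w).re) k U X w
          - (fun k U X w => Real.exp (-(κ * T.d X)) * (ℓ k U X w).re) k U X w'| ≤ ε := by
  intro m ε hε
  refine ⟨ε, hε, fun k U X _ w _ w' _ hd => ?_⟩
  have he : Real.exp (κ * T.d X) * Real.exp (-(κ * T.d X)) = 1 := by rw [← Real.exp_add, add_neg_cancel, Real.exp_zero]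
  have hre : |(ℓ k U X w).re - (ℓ k U X w').re| ≤ ‖w - w'‖ := by
    rw [← Complex.sub_re, ← map_sub]
    exact (Complex.abs_re_le_norm _).trans (((ℓ k U X).le_of_opNorm_le (hℓ k U X) _).trans (by rw [one_mul]))
  rw [dist_eq_norm] at hd
  calc Real.exp (κ * T.d X) * |Real.exp (-(κ * T.d X)) * (ℓ k U X w).re - Real.exp (-(κ * T.d X)) * (ℓ k U X w').re|
      = |(ℓ k U X w).re - (ℓ k U X w').re| := by
        rw [← mul_sub, abs_mul, abs_of_pos (Real.exp_pos _), ← mul_assoc, he, one_mul]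
    _ ≤ ‖w - w'‖ := hre
    _ ≤ ε := hd

omit [CompleteSpace F] in
/-- **THE (1.18)-TYPE BOUND FROM CLASS MEMBERSHIP** (the `hB` binder with `B = E₀`): states in the closed `E₀`-ball and coordinate read-outs of
norm `≤ 1` give `e^{κd(X)}·|E k g U X| ≤ E₀`. [folklore] -/
theorem bound_of_coordinate (hℓ : ∀ k U X, ‖ℓ k U X‖ ≤ 1) {I : Set ℝ} {E₀ : ℝ} {V : ℕ → ℕ → (ℕ → ℝ) → F}
    {E : ℕ → (ℕ → ℝ) → T.B → T.Dom → ℝ}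
    (hmem : ∀ k m, ∀ g ∈ BoxWindow I, V k m g ∈ closedBall (0 : F) E₀)
    (hE : ∀ (k : ℕ) (U : T.B) (X : T.Dom), ∀ g ∈ BoxWindow I,
      E k g U X = Real.exp (-(κ * T.d X)) * (ℓ k U X (V k (k - T.r X) g)).re) :
    ∀ (k : ℕ) (U : T.B) (X : T.Dom), ∀ g ∈ BoxWindow I, Real.exp (κ * T.d X) * |E k g U X| ≤ E₀ := by
  intro k U X g hg
  have he : Real.exp (κ * T.d X) * Real.exp (-(κ * T.d X)) = 1 := by rw [← Real.exp_add, add_neg_cancel, Real.exp_zero]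
  have hw := hmem k (k - T.r X) g hg
  rw [mem_closedBall, dist_zero_right] at hw
  rw [hE k U X g hg, abs_mul, abs_of_pos (Real.exp_pos _), ← mul_assoc, he, one_mul]
  exact (Complex.abs_re_le_norm _).trans ((((ℓ k U X).le_of_opNorm_le (hℓ k U X) _).trans (by rw [one_mul])).trans hw)

end ReadOut

/-! ## §3 Node U6 in King's currency from channel constants (every E-side binder a structure or a printed-KIND constant) -/

section Assembly

variable (T : TowerData) {I : Set ℝ} {κ : ℝ}
  {J : ℕ → ℕ → ℝ → (F →L[ℂ] F)} {Tp : ℕ → ℕ → ℝ → (F →L[ℂ] P)} {G : ℕ → ℕ → ℝ → P → F}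
  {V : ℕ → ℕ → (ℕ → ℝ) → F} {ℓ : ℕ → T.B → T.Dom → (F →L[ℂ] ℂ)} {E : ℕ → (ℕ → ℝ) → T.B → T.Dom → ℝ}
  {E₀ : ℝ} {R M CJ CT ϱ : ℕ → ℝ}

/-- **NODE U6 IN KING'S CURRENCY FROM THE LINEAR CHANNEL** (`DirectPairingMargin.king_U6_of_margin` BY NAME, its `hold`∕`hev`∕`hB` binders
discharged by §1–§2).  E-side inputs, all displayed: tower-NE5 (`h5`); one Markov recursion per run `k` through the linear channel
(`hrec`: `V k (j+1) g = J k j (g j) (V k j g) + G k j (g j) (Tp k j (g j) (V k j g))`) with a coupling-free start (`h0`); class reproduction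
`‖V k j g‖ ≤ E₀` (`hmem`, (1.18) + [II] p. 21); channel constants per level, uniform in run and coupling — `G` holomorphic and bounded by `M j` on
the potential ball of radius `R j` ((2.14)–(2.20)), `‖J‖ ≤ C_J j`, `‖Tp‖ ≤ C_T j` ((1.36)) — with SLACK `C_T j·(E₀ + ϱ j) < R j`; (AN-LAST)+margin
(`hLa`); coordinate read-outs `E k g U X = e^{−κd(X)}·Re ℓ(V k (k − r X) g)`, `‖ℓ‖ ≤ 1` (`hE`, `hℓ`); node U2's K-uniform summable consecutive
profile (`ht`, `hp`, `hps`).  Conclusion: a scale profile `b_j → 0` dominating the direct bracket of the runs `K`, `K + n` and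
`T4CauchySum.delta E₀' ρ inj K → 0` under it.  No modulus, no older coupling, no stabilisation among the hypotheses. [folklore] -/
theorem king_U6_of_linearChannel {θ C₅ : ℝ} {p : ℕ → ℝ} {t : ℕ → ℕ → ℝ}
    (hC : 0 ≤ C₅) (hθ0 : 0 ≤ θ) (hθ1 : θ < 1) (h5 : TowerNE5On T E I κ θ C₅)
    (h0 : ∀ k, ∀ g ∈ BoxWindow I, ∀ g' ∈ BoxWindow I, V k 0 g = V k 0 g')
    (hrec : ∀ k j, ∀ g ∈ BoxWindow I, V k (j + 1) g = J k j (g j) (V k j g) + G k j (g j) (Tp k j (g j) (V k j g)))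
    (hE₀ : 0 ≤ E₀) (hmem : ∀ k m, ∀ g ∈ BoxWindow I, V k m g ∈ closedBall (0 : F) E₀)
    (hϱ : ∀ j, 0 < ϱ j)
    (hG : ∀ k j, ∀ c ∈ I, DifferentiableOn ℂ (G k j c) (ball 0 (R j)))
    (hM : ∀ k j, ∀ c ∈ I, ∀ q ∈ ball (0 : P) (R j), ‖G k j c q‖ ≤ M j)
    (hJ : ∀ k j, ∀ c ∈ I, ‖J k j c‖ ≤ CJ j) (hT : ∀ k j, ∀ c ∈ I, ‖Tp k j c‖ ≤ CT j)
    (hslack : ∀ j, CT j * (E₀ + ϱ j) < R j)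
    (hLa : ∀ j, ∃ ϱ' M' : ℝ, 0 < ϱ' ∧ ∀ k, ∀ w ∈ closedBall (0 : F) E₀, ∃ (Ψ : ℂ → F) (D : Set ℂ),
      DifferentiableOn ℂ Ψ D ∧ (∀ z ∈ D, ‖Ψ z‖ ≤ M') ∧ (∀ c ∈ I, closedBall (c : ℂ) ϱ' ⊆ D) ∧
        ∀ c ∈ I, Ψ c = J k j c w + G k j c (Tp k j c w))
    (hℓ : ∀ k U X, ‖ℓ k U X‖ ≤ 1)
    (hE : ∀ (k : ℕ) (U : T.B) (X : T.Dom), ∀ g ∈ BoxWindow I,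
      E k g U X = Real.exp (-(κ * T.d X)) * (ℓ k U X (V k (k - T.r X) g)).re)
    (ht : ∀ K, t K ∈ BoxWindow I) (hp : ∀ K i, |t (K + 1) (i + 1) - t K i| ≤ p i) (hp0 : ∀ i, 0 ≤ p i) (hps : Summable p) :
    ∃ b : ℕ → ℝ, (∀ j, 0 ≤ b j) ∧ Tendsto b atTop (𝓝 0) ∧
      (∀ (K n : ℕ) (U : T.B) (X : T.Dom), T.r X ≤ K →
        |E (K + n) (t (K + n)) U X - E K (t K) (T.descend (K + n) U K) X| ≤ b (K - T.r X) * Real.exp (-(κ * T.d X))) ∧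
      ∀ (E₀' ρ : ℝ) (inj : ℕ → ℕ → ℝ), 0 ≤ E₀' → 0 ≤ ρ → ρ < 1 →
        (∀ K j : ℕ, j ≤ K → 0 ≤ inj K j ∧ inj K j ≤ b j) → Tendsto (delta E₀' ρ inj) atTop (𝓝 0) :=
  king_U6_of_margin T (V := V) (Φ := fun k j c w => J k j c w + G k j c (Tp k j c w)) (A := fun _ => closedBall (0 : F) E₀)
    (ev := fun k U X w => Real.exp (-(κ * T.d X)) * (ℓ k U X w).re)
    hC hθ0 hθ1 h5 h0 hrec hmem
    (oldMargin_of_linearChannel (E₀ := fun _ => E₀) hϱ hG hM hJ hT hslack) hLa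
    (readOut_uniform_of_coordinate T hℓ _) hE hE₀ (bound_of_coordinate T hℓ hmem hE) ht hp hp0 hps

end Assembly

end Summit.QuantumFields.BalabanUV.T4Continuum.NE9.DirectPairingMarginChannel
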